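import Summits.HodgeConjecture.CorCM.Census.OddSliceFacesCount
import Summits.HodgeConjecture.CorCM.Census.CyclicPrimeFacesSlice

/-!
# Faces generate the Hodge lattice of the faithful full odd slice, IV: transport to the model of record — b17's `oddSlice_law` is an
# equality, attained by rank-four face classes, for every finite abelian group `A` of odd order

COR-CM (cell `pub-hodgecm2`), count-neutral kernel census by the binder seat b09 (gen 26; lane ODD-SLICE-FACES, part VI of
`OddSliceFacesModel` → `OddSliceFacesSquares` → `OddSliceFacesDescent` → `OddSliceFacesGenerate` → `OddSliceFacesCount` →
`OddSliceFacesRecord`; gen 25's `Census/CyclicPrimeFacesSlice.lean` with b17's cyclic-prime model `AbO/πO/φO` replaced by b17's model of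
the faithful full slice of `(ℤ/2 × A, (1,0))` for ANY abelian `A` of odd order, `Census/OddDegreeParityLawCyclicPrime.lean` §5).
Bookkeeping definitions + theorems; no `decide` table, no certificate, no named fact, no geometry, no `sorry`.  HC_CM is not proved
anywhere in this cell; nothing here is a headline and nothing here produces a period.

THE BRIDGE.  b17's model of record: blocks `Option (OrbitsA A)` (`none = E`, `some ω` = the simple factor of the `G`-orbit `ω` of
nonconstant types), label groups `AbQ A` (`A_E = 0`, `A_ω = A / Per(φ_ω)` for the CHOSEN representative `φ_ω = Quotient.out ω`), `πQ`
(quotient maps), types `φQ` (descended representatives), labels `Pt (AbQ A) = Σ b, ℤ/2 × A_b`, `hodgeVec`, `hodgeLattice (πQ A) (φQ A)`,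
`pairs`, `transl`.  The map «label ↦ its type» `toTy : Pt (AbQ A) → Ty A`, `(b, a, q) ↦ (s ↦ φ_b(π_b s + q) + a)` — on `E` the constant
type `a`, on the block of `ω` the twist `tw (a, y) φ_ω` for any lift `y` of `q` — is a BIJECTION when `|A|` is odd (`toTyEquiv`;
injectivity = b17's `stabiliser_fst_eq_zero`: stabilisers are `{0} × Per`, surjectivity = every type is constant or a twist of the
representative of its orbit) which matches Pohlmann coefficients (`hodgeVec_eq_coef`), the action (`toTy_act`), conjugation
(`toTy_conj`), hence the Hodge lattices (`mem_hodgeLattice_iff`), the pairs and the translates (`pull_pairVec`, `pull_transl`) of the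
representative-free model of parts I–V.  So the choice of representatives in `φQ` is immaterial, as b17's docstring says.

THE THEOREM OF RECORD (**`oddSlice_faces`**, **`oddSlice_law_eq`**).  For every finite abelian group `A` of odd order there is a family
`S` of exactly `|OrbitsA A|` (= the number of isogeny classes of simple CM abelian varieties split by `F` other than `E`) vectors of b17's
model, each a FACE CLASS (`faceClassQ φ i j`: the indicator of the four labels whose types are the corners `φ, φ̄^{(i)}, φ̄^{(j)},
φ^{(ij)}` of a rank-four face `(φ; i, j)`, `i ≠ j`), with `hodgeLattice (πQ A) (φQ A) ≤ pairs ⊔ ℤ⟨transl (πQ A) g t : g ∈ G, t ∈ S⟩` —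
and by b17's `oddSlice_law` no family of fewer vectors of any kind does it: **`μ(ℤ/2 × A) = |OrbitsA A|`, ATTAINED BY FACES**.
Instances by b17's orbit counts (`Census/OddDegreeParityLawRelative.lean` §2–§3): `oddCyclic_faces` (`ℤ/2n`, `n` odd:
`(Σ_{a<n} (2^{gcd(n,a)} − 2))/2n` faces), `zmod_nine_faces` (degree `18`, cyclic: `29` faces), `zmod_three_sq_faces` (`ℤ/6 × ℤ/3`: `31`),
`zmod_fifteen_faces` (degree `30`, cyclic: `1095`) — b17's `zmod_eighteen_law`, `zmod_six_three_law`, `zmod_thirty_law` are equalities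
attained by faces; the degree-`18` rows agree with lit-andre-3's kernel certificates `Census/OctadecicCyclicLattice.lean`,
`Census/OctadecicC6C3Lattice.lean` (29 and 31 type squares), degree `30` had no certificate.  Dictionary reading (lane 2 of the cell,
«what is open by type»): for a Galois CM field `F` with `Gal(F/ℚ) = ℤ/2 × A` abelian of order `≡ 2 (mod 4)`, the Hodge ring of the
whole slice of `F` (every abelian variety dominated by a product of CM abelian varieties with CM inside `F`) modulo divisor classes
is generated by the Galois conjugates of EXACTLY `|OrbitsA A|` classes, and rank-four FACE classes achieve it — uniformly in `A`.
Nothing here computes a period.  All [folklore].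

## References
* [Pohlmann1968] H. Pohlmann, Algebraic cycles on abelian varieties of complex multiplication type, Ann. of Math. 88 (1968), Thm 1.
* [Milne1999] J. S. Milne, Lefschetz motives and the Tate conjecture, Compositio Math. 117 (1999), Prop. 2.1, p. 54.
* [Weil1977HodgeRing] A. Weil, Abelian varieties and the Hodge ring, Œuvres Scientifiques III, [1977c], 421–429.
-/

namespace Summit.HodgeConjecture.CorCM.Census.OddSliceFacesRecord

open Finset
open Summit.HodgeConjecture.CorCM.Census.OddSliceFacesModel
open Summit.HodgeConjecture.CorCM.Census.OddSliceFacesSquares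
open Summit.HodgeConjecture.CorCM.Census.OddSliceFacesDescent
open Summit.HodgeConjecture.CorCM.Census.OddSliceFacesGenerate
open Summit.HodgeConjecture.CorCM.Census.OddSliceFacesCount
open Summit.HodgeConjecture.CorCM.Census.OddDegreeParityLaw (Pt AbQ πQ φQ OrbitsA Nonconst periods act conj hodgeVec hodgeLattice)

variable (A : Type) [AddCommGroup A] [Fintype A] [DecidableEq A]

/-! ## §1 The bijection «label ↦ type» -/

/-- The type carried by a label of b17's model: `(b, a, q) ↦ (s ↦ φ_b(π_b s + q) + a)` — on `E` the constant type `a`, on the block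
of `ω` the twist `tw (a, y) (out ω)` for any lift `y` of `q`. [folklore] -/
noncomputable def toTy (x : Pt (AbQ A)) : Ty A := fun s => φQ A x.1 (πQ A x.1 s + x.2.2) + x.2.1

omit [Fintype A] [DecidableEq A] in
/-- **Pohlmann coefficients match**: b17's `hodgeVec g x` is the coefficient of `g` at the type of `x`. [folklore] -/
theorem hodgeVec_eq_coef (g : ZMod 2 × A) (x : Pt (AbQ A)) : hodgeVec (πQ A) (φQ A) g x = coef A g (toTy A x) := by
  have key : ∀ a b u : ZMod 2, a + b = u ↔ u + a = b := by decide
  unfold hodgeVec coef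
  refine CyclicPrimeFacesSlice.ite_congr_iff ?_
  simp only [OddDegreeParityLaw.inPhi, act, toTy, decide_eq_true_eq]
  rw [add_comm (x.2.2)]
  exact key _ _ _

omit [Fintype A] [DecidableEq A] in
/-- The type map intertwines b17's action on labels with the twist. [folklore] -/
theorem toTy_act (g : ZMod 2 × A) (x : Pt (AbQ A)) : toTy A (act (πQ A) g x) = tw A g (toTy A x) := by
  funext s
  simp only [toTy, act, tw, map_add]
  rw [add_comm x.2.2 (πQ A x.1 g.2), add_assoc, add_assoc]
  rfl

omit [Fintype A] [DecidableEq A] in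
/-- The type map sends conjugate labels to conjugate types. [folklore] -/
theorem toTy_conj (x : Pt (AbQ A)) : toTy A (conj x) = toTy A x + 1 := by
  funext s
  simp only [toTy, conj, Pi.add_apply, Pi.one_apply]
  rw [add_assoc]
  rfl

omit [Fintype A] [DecidableEq A] in
/-- On the block of `E` the type map is the constant type. [folklore] -/
theorem toTy_none (a : ZMod 2) (u : AbQ A none) (s : A) : toTy A ⟨none, (a, u)⟩ s = a := by
  show φQ A none _ + a = a
  simp [OddDegreeParityLaw.φQ]

omit [Fintype A] [DecidableEq A] in
/-- On the block of `ω` the type map is b17's action: `toTy (ω, a, [y]) = ((a, −y) +ᵥ out ω).1`. [folklore] -/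
theorem toTy_some (ω : OrbitsA A) (a : ZMod 2) (y : A) :
    toTy A ⟨some ω, (a, (y : A ⧸ periods (Quotient.out ω : Nonconst A).1))⟩ =
      (((a, -y) : ZMod 2 × A) +ᵥ Quotient.out ω).1 := by
  rw [vadd_val_eq_tw, neg_neg]
  funext s
  show OddDegreeParityLaw.descend (Quotient.out ω).1 ((QuotientAddGroup.mk' _ s) + (y : A ⧸ periods (Quotient.out ω).1)) + a =
    (Quotient.out ω).1 (s + y) + a
  rw [QuotientAddGroup.mk'_apply, ← QuotientAddGroup.mk_add, OddDegreeParityLaw.descend_mk]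

omit [Fintype A] [DecidableEq A] in
/-- Every label of the block of `ω` has the form `(ω, a, [y])`. [folklore] -/
theorem exists_mk_eq (ω : OrbitsA A) (q : AbQ A (some ω)) : ∃ y : A, (y : A ⧸ periods (Quotient.out ω : Nonconst A).1) = q :=
  QuotientAddGroup.mk_surjective q

omit [DecidableEq A] in
/-- **The type map is injective** (`|A|` odd: stabilisers are `{0} × Per`, b17's `stabiliser_fst_eq_zero`). [folklore] -/
theorem toTy_injective (hA : Odd (Fintype.card A)) : Function.Injective (toTy A) := by
  intro x x' h
  obtain ⟨_ | ω, a, q⟩ := x <;> obtain ⟨_ | ω', a', q'⟩ := x'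
  · -- E / E
    have ha : a = a' := by have := congrFun h 0; rwa [toTy_none, toTy_none] at this
    subst ha
    cases q; cases q'; rfl
  · -- E / block: a constant type is not a twist of a nonconstant one
    exfalso
    obtain ⟨y', rfl⟩ := exists_mk_eq A ω' q'
    apply (((a', -y') : ZMod 2 × A) +ᵥ Quotient.out ω').2
    intro s
    have h1 := congrFun h s
    have h0 := congrFun h 0
    rw [toTy_some, toTy_none] at h1 h0
    rw [← h1, ← h0]
  · -- block / E
    exfalso
    obtain ⟨y, rfl⟩ := exists_mk_eq A ω q
    apply (((a, -y) : ZMod 2 × A) +ᵥ Quotient.out ω).2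
    intro s
    have h1 := congrFun h s
    have h0 := congrFun h 0
    rw [toTy_some, toTy_none] at h1 h0
    rw [h1, h0]
  · -- block / block
    obtain ⟨y, rfl⟩ := exists_mk_eq A ω q
    obtain ⟨y', rfl⟩ := exists_mk_eq A ω' q'
    rw [toTy_some, toTy_some] at h
    have h' : ((a, -y) : ZMod 2 × A) +ᵥ Quotient.out ω = ((a', -y') : ZMod 2 × A) +ᵥ Quotient.out ω' := Subtype.ext h
    -- same orbit
    have hω : ω = ω' := by
      rw [← Quotient.out_eq ω, ← Quotient.out_eq ω']
      refine Quotient.sound (AddAction.orbitRel_apply.mpr (AddAction.mem_orbit_iff.mpr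
        ⟨-((a, -y) : ZMod 2 × A) + (a', -y'), ?_⟩))
      rw [add_vadd, ← h', neg_vadd_vadd]
    subst hω
    -- the difference stabilises the representative
    have hfix : (-((a', -y') : ZMod 2 × A) + (a, -y)) +ᵥ Quotient.out ω = Quotient.out ω := by
      rw [add_vadd, h', neg_vadd_vadd]
    have hfix' : ∀ s, (Quotient.out ω).1 (s - (-(-y') + -y)) + (-a' + a) = (Quotient.out ω).1 s := fun s => by
      have := congrArg (fun ψ : Nonconst A => ψ.1 s) hfix
      simpa [OddDegreeParityLaw.vadd_val] using this
    obtain ⟨ha, hper⟩ := OddDegreeParityLaw.stabiliser_fst_eq_zero hA _ _ _ hfix'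
    have ha' : a = a' := by
      have key : ∀ u v : ZMod 2, -u + v = 0 → v = u := by decide
      exact key _ _ ha
    subst ha'
    have hq : (y : A ⧸ periods (Quotient.out ω : Nonconst A).1) = (y' : A ⧸ periods (Quotient.out ω : Nonconst A).1) := by
      rw [QuotientAddGroup.eq]
      have hmem : (-(-y') + -y : A) ∈ periods (Quotient.out ω : Nonconst A).1 := hper
      have : -y + y' = -(-y') + -y := by abel
      rw [this]
      exact hmem
    rw [hq]

omit [DecidableEq A] in
/-- **The type map is surjective**: every type is constant or a twist of the representative of its orbit. [folklore] -/
theorem toTy_surjective : Function.Surjective (toTy A) := by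
  intro ψ
  by_cases hc : ∀ y, ψ y = ψ 0
  · refine ⟨⟨none, (ψ 0, PUnit.unit)⟩, ?_⟩
    funext s
    rw [toTy_none]
    exact (hc s).symm
  · set φ : Nonconst A := ⟨ψ, hc⟩ with hφ
    set ω : OrbitsA A := Quotient.mk _ φ with hω
    have hrel : (AddAction.orbitRel (ZMod 2 × A) (Nonconst A)) (Quotient.out ω) φ := Quotient.mk_out φ
    obtain ⟨g, hg⟩ := AddAction.mem_orbit_iff.mp (AddAction.orbitRel_apply.mp hrel)
    refine ⟨⟨some ω, ((-g).1, (g.2 : A ⧸ periods (Quotient.out ω : Nonconst A).1))⟩, ?_⟩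
    rw [toTy_some]
    have : (((-g).1, -g.2) : ZMod 2 × A) = -g := rfl
    rw [this, ← hg, neg_vadd_vadd]

/-- **The bijection «label ↦ type»** between b17's labels and the representative-free labels (`|A|` odd). [folklore] -/
noncomputable def toTyEquiv (hA : Odd (Fintype.card A)) : Pt (AbQ A) ≃ Ty A :=
  Equiv.ofBijective (toTy A) ⟨toTy_injective A hA, toTy_surjective A⟩

omit [DecidableEq A] in
/-- `toTyEquiv` is `toTy`. [folklore] -/
@[simp] theorem toTyEquiv_apply (hA : Odd (Fintype.card A)) (x : Pt (AbQ A)) : toTyEquiv A hA x = toTy A x := rfl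

/-! ## §2 Transport of exponent vectors: Hodge lattice, pairs, translates -/

/-- Pull-back of exponent vectors along the bijection: `(pull v)(x) = v (type of x)`. [folklore] -/
noncomputable def pull (hA : Odd (Fintype.card A)) : (Ty A → ℤ) ≃ₗ[ℤ] (Pt (AbQ A) → ℤ) :=
  LinearEquiv.funCongrLeft ℤ ℤ (toTyEquiv A hA)

omit [DecidableEq A] in
/-- `pull v x = v (toTy x)`. [folklore] -/
theorem pull_apply (hA : Odd (Fintype.card A)) (v : Ty A → ℤ) (x : Pt (AbQ A)) : pull A hA v x = v (toTy A x) := rfl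

omit [DecidableEq A] in
/-- The inverse transport: `(pull.symm m) (toTy x) = m x`. [folklore] -/
theorem pull_symm_apply (hA : Odd (Fintype.card A)) (m : Pt (AbQ A) → ℤ) (x : Pt (AbQ A)) :
    (pull A hA).symm m (toTy A x) = m x := by
  have h := pull_apply A hA ((pull A hA).symm m) x
  rw [LinearEquiv.apply_symm_apply] at h
  exact h.symm

/-- **The Hodge lattices correspond**: `m` is a Hodge vector of b17's model iff its push-forward is one of the representative-free
model. [folklore] -/
theorem mem_hodgeLattice_iff (hA : Odd (Fintype.card A)) (m : Pt (AbQ A) → ℤ) :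
    m ∈ hodgeLattice (πQ A) (φQ A) ↔ (pull A hA).symm m ∈ hodge A := by
  have hform : ∀ g : ZMod 2 × A, coef A g ⬝ᵥ (pull A hA).symm m = hodgeVec (πQ A) (φQ A) g ⬝ᵥ m := by
    intro g
    have h1 : (pull A hA).symm m = m ∘ (toTyEquiv A hA).symm := by
      funext ψ
      have := pull_symm_apply A hA m ((toTyEquiv A hA).symm ψ)
      rw [← toTyEquiv_apply A hA, Equiv.apply_symm_apply] at this
      exact this
    rw [h1, dotProduct_comp_equiv_symm]
    congr 1
    funext x
    exact (hodgeVec_eq_coef A g x).symm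
  constructor
  · intro h g; rw [hform]; exact h g
  · intro h g; rw [← hform]; exact h g

omit [DecidableEq A] in
/-- Pull-back of a unit vector. [folklore] -/
theorem pull_single (hA : Odd (Fintype.card A)) (ψ : Ty A) (c : ℤ) :
    pull A hA (Pi.single ψ c) = Pi.single ((toTyEquiv A hA).symm ψ) c := by
  funext x
  rw [pull_apply, Pi.single_apply, Pi.single_apply]
  have hiff : toTy A x = ψ ↔ x = (toTyEquiv A hA).symm ψ := by
    rw [← toTyEquiv_apply A hA, Equiv.eq_symm_apply]
  simp only [hiff]

omit [DecidableEq A] in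
/-- **Pairs correspond**: the pull-back of a pair is a pair. [folklore] -/
theorem pull_pairVec (hA : Odd (Fintype.card A)) (ψ : Ty A) :
    pull A hA (pairVec A ψ) = OddDegreeParityLaw.pairVec ((toTyEquiv A hA).symm ψ) := by
  unfold pairVec OddDegreeParityLaw.pairVec
  rw [map_add, pull_single, pull_single]
  congr 2
  apply (toTyEquiv A hA).injective
  rw [Equiv.apply_symm_apply, toTyEquiv_apply, toTy_conj, ← toTyEquiv_apply A hA, Equiv.apply_symm_apply]

omit [DecidableEq A] in
/-- **Translates correspond**: the pull-back of a Galois translate is the Galois translate of the pull-back. [folklore] -/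
theorem pull_transl (hA : Odd (Fintype.card A)) (g : ZMod 2 × A) (v : Ty A → ℤ) :
    pull A hA (transl A g v) = OddDegreeParityLaw.transl (πQ A) g (pull A hA v) := by
  funext x
  show v (tw A (-g) (toTy A x)) = v (toTy A (act (πQ A) (-g) x))
  rw [toTy_act]

/-- Transport of a generation statement `H ≤ P ⊔ spanFaces T` of the representative-free model to b17's model. [folklore] -/
theorem hodgeLattice_le_of_spanFaces (hA : Odd (Fintype.card A)) {T : Finset (Ty A × A × A)}
    (hT : hodge A ≤ pairs A ⊔ spanFaces A T) :
    hodgeLattice (πQ A) (φQ A) ≤ OddDegreeParityLaw.pairs ⊔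
      Submodule.span ℤ {v | ∃ g : ZMod 2 × A, ∃ t ∈ T.image (fun f => pull A hA (faceVec A f.1 f.2.1 f.2.2)),
        v = OddDegreeParityLaw.transl (πQ A) g t} := by
  intro m hm
  set W := Submodule.span ℤ {v | ∃ g : ZMod 2 × A, ∃ t ∈ T.image (fun f => pull A hA (faceVec A f.1 f.2.1 f.2.2)),
    v = OddDegreeParityLaw.transl (πQ A) g t} with hW
  have hX : (pull A hA).symm m ∈ pairs A ⊔ spanFaces A T := hT ((mem_hodgeLattice_iff A hA m).mp hm)
  have hP : (pairs A).map (pull A hA).toLinearMap ≤ OddDegreeParityLaw.pairs := by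
    rw [Submodule.map_le_iff_le_comap]
    refine Submodule.span_le.mpr ?_
    rintro _ ⟨ψ, rfl⟩
    simp only [SetLike.mem_coe, Submodule.mem_comap, LinearEquiv.coe_coe, pull_pairVec]
    exact Submodule.subset_span ⟨_, rfl⟩
  have hF : (spanFaces A T).map (pull A hA).toLinearMap ≤ W := by
    rw [Submodule.map_le_iff_le_comap]
    refine Submodule.span_le.mpr ?_
    rintro _ ⟨g, f, hf, rfl⟩
    simp only [SetLike.mem_coe, Submodule.mem_comap, LinearEquiv.coe_coe, pull_transl]
    exact Submodule.subset_span ⟨g, _, Finset.mem_image_of_mem _ hf, rfl⟩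
  have hm' : m = pull A hA ((pull A hA).symm m) := ((pull A hA).apply_symm_apply m).symm
  rw [hm']
  obtain ⟨a, ha, b, hb, hab⟩ := Submodule.mem_sup.mp hX
  rw [← hab, map_add]
  exact Submodule.add_mem _ (Submodule.mem_sup_left (hP ⟨a, ha, rfl⟩)) (Submodule.mem_sup_right (hF ⟨b, hb, rfl⟩))

/-! ## §3 The theorem of record -/

/-- **The class of the rank-four face `(φ; i, j)` in b17's model** of the faithful full slice of `(ℤ/2 × A, (1,0))`: the indicator of
the four labels whose types are the corners `φ, φ̄^{(i)} = φ + 1 + δ i, φ̄^{(j)}, φ^{(ij)} = φ + δ i + δ j` — the exponent vector of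
the `1`-eigencomponent of the Weil line of the face (`faceClassQ_apply`). [folklore] -/
noncomputable def faceClassQ (φ : Ty A) (i j : A) : Pt (AbQ A) → ℤ := fun x => faceVec A φ i j (toTy A x)

/-- The face class is the indicator of the four labels carrying the four corner types. [folklore] -/
theorem faceClassQ_apply (φ : Ty A) (i j : A) (x : Pt (AbQ A)) : faceClassQ A φ i j x =
    (if toTy A x = φ then 1 else 0) + (if toTy A x = φ + 1 + δ A i then 1 else 0) +
      (if toTy A x = φ + 1 + δ A j then 1 else 0) + (if toTy A x = φ + δ A i + δ A j then 1 else 0) :=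
  faceVec_apply A φ i j (toTy A x)

/-- **THE THEOREM OF RECORD (faces suffice, every odd order).**  In b17's model of the faithful full slice of the Galois CM type
`(ℤ/2 × A, (1,0))`, `A` a finite abelian group of odd order, there is a family `S` of exactly `|OrbitsA A|` FACE CLASSES — one per
isogeny class of simple CM abelian varieties split by `F` other than `E` — whose Galois translates generate the Hodge lattice together
with the divisor classes. [folklore] -/
theorem oddSlice_faces (hA : Odd (Fintype.card A)) :
    ∃ S : Finset (Pt (AbQ A) → ℤ), S.card = Nat.card (OrbitsA A) ∧
      (∀ t ∈ S, ∃ (φ : Ty A) (i j : A), i ≠ j ∧ t = faceClassQ A φ i j) ∧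
      hodgeLattice (πQ A) (φQ A) ≤ OddDegreeParityLaw.pairs ⊔
        Submodule.span ℤ {v | ∃ g : ZMod 2 × A, ∃ t ∈ S, v = OddDegreeParityLaw.transl (πQ A) g t} := by
  have hodd : Fintype.card A % 2 = 1 := Nat.odd_iff.mp hA
  by_cases h3 : 3 ≤ Fintype.card A
  · have hgen := hodgeLattice_le_of_spanFaces A hA (hodge_le_pairs_sup_spanFaces_family A hA h3)
    refine ⟨_, ?_, ?_, hgen⟩
    · refine le_antisymm ?_ (OddDegreeParityLaw.oddSlice_law A hA _ hgen)
      rw [Nat.card_eq_fintype_card]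
      exact Finset.card_image_le.trans (family_card A h3).le
    · intro t ht
      obtain ⟨f, hf, rfl⟩ := Finset.mem_image.mp ht
      exact ⟨f.1, f.2.1, f.2.2, family_places A h3 hf, rfl⟩
  · have h1 : Fintype.card A = 1 := by omega
    obtain ⟨hO, hsq⟩ := card_eq_zero_of_card_eq_one A h1
    have hgen := hodgeLattice_le_of_spanFaces A hA (hodge_le_pairs_sup_spanFaces_squares A hA h1)
    refine ⟨_, ?_, ?_, hgen⟩
    · rw [Finset.card_eq_zero.mp hsq, Finset.image_empty, Finset.card_empty, Nat.card_eq_fintype_card, hO]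
    · intro t ht
      obtain ⟨f, hf, rfl⟩ := Finset.mem_image.mp ht
      exact ⟨f.1, f.2.1, f.2.2, squares_places A hf, rfl⟩

/-- **`μ(ℤ/2 × A) = |OrbitsA A|`, ATTAINED BY FACES** (b17's `oddSlice_law` is an equality, every abelian `A` of odd order): the least
number of Galois orbits of integer vectors generating the Hodge lattice of the faithful full slice modulo divisor classes is the number
of isogeny classes of simple CM abelian varieties split by `F` other than `E`, and that many rank-four face classes achieve it.
[folklore] -/
theorem oddSlice_law_eq (hA : Odd (Fintype.card A)) :
    (∃ S : Finset (Pt (AbQ A) → ℤ), S.card = Nat.card (OrbitsA A) ∧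
      (∀ t ∈ S, ∃ (φ : Ty A) (i j : A), i ≠ j ∧ t = faceClassQ A φ i j) ∧
      hodgeLattice (πQ A) (φQ A) ≤ OddDegreeParityLaw.pairs ⊔
        Submodule.span ℤ {v | ∃ g : ZMod 2 × A, ∃ t ∈ S, v = OddDegreeParityLaw.transl (πQ A) g t}) ∧
    (∀ S : Finset (Pt (AbQ A) → ℤ), hodgeLattice (πQ A) (φQ A) ≤ OddDegreeParityLaw.pairs ⊔
        Submodule.span ℤ {v | ∃ g : ZMod 2 × A, ∃ t ∈ S, v = OddDegreeParityLaw.transl (πQ A) g t} →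
      Nat.card (OrbitsA A) ≤ S.card) :=
  ⟨oddSlice_faces A hA, fun S hS => OddDegreeParityLaw.oddSlice_law A hA S hS⟩

/-! ## §4 Instances by b17's orbit counts: cyclic `ℤ/2n`, degrees `18` (both Galois types) and `30` -/

/-- **`μ(ℤ/2n) = (Σ_{a<n} (2^{gcd(n,a)} − 2))/2n` by faces**, `n` odd (b17's `oddCyclic_law` is an equality): `1, 3, 9, 29, 93, 315, 1095`
faces for `2n = 6, 10, 14, 18, 22, 26, 30`. [folklore] -/
theorem oddCyclic_faces (n : ℕ) [NeZero n] (hn : Odd n) :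
    ∃ S : Finset (Pt (AbQ (ZMod n)) → ℤ), S.card = (∑ a ∈ Finset.range n, (2 ^ n.gcd a - 2)) / (2 * n) ∧
      (∀ t ∈ S, ∃ (φ : Ty (ZMod n)) (i j : ZMod n), i ≠ j ∧ t = faceClassQ (ZMod n) φ i j) ∧
      hodgeLattice (πQ (ZMod n)) (φQ (ZMod n)) ≤ OddDegreeParityLaw.pairs ⊔
        Submodule.span ℤ {v | ∃ g : ZMod 2 × ZMod n, ∃ t ∈ S, v = OddDegreeParityLaw.transl (πQ (ZMod n)) g t} := by
  have hA : Odd (Fintype.card (ZMod n)) := by rwa [ZMod.card]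
  have hpos : 0 < 2 * n := by have := NeZero.pos n; omega
  rw [← OddDegreeParityLaw.card_orbitsA_zmod_mul n hn, Nat.mul_div_cancel _ hpos]
  exact oddSlice_faces (ZMod n) hA

/-- **Degree `18`, cyclic (`ℚ(ζ₁₉)`, `ℚ(ζ₂₇)`, …): `μ(ℤ/18) = 29`, attained by `29` rank-four face classes.** [folklore] -/
theorem zmod_nine_faces :
    ∃ S : Finset (Pt (AbQ (ZMod 9)) → ℤ), S.card = 29 ∧
      (∀ t ∈ S, ∃ (φ : Ty (ZMod 9)) (i j : ZMod 9), i ≠ j ∧ t = faceClassQ (ZMod 9) φ i j) ∧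
      hodgeLattice (πQ (ZMod 9)) (φQ (ZMod 9)) ≤ OddDegreeParityLaw.pairs ⊔
        Submodule.span ℤ {v | ∃ g : ZMod 2 × ZMod 9, ∃ t ∈ S, v = OddDegreeParityLaw.transl (πQ (ZMod 9)) g t} := by
  rw [← OddDegreeParityLaw.card_orbitsA_zmod_nine]
  exact oddSlice_faces (ZMod 9) (by rw [ZMod.card]; decide)

/-- **Degree `18`, type `ℤ/6 × ℤ/3`: `μ = 31`, attained by `31` rank-four face classes.** [folklore] -/
theorem zmod_three_sq_faces :
    ∃ S : Finset (Pt (AbQ (ZMod 3 × ZMod 3)) → ℤ), S.card = 31 ∧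
      (∀ t ∈ S, ∃ (φ : Ty (ZMod 3 × ZMod 3)) (i j : ZMod 3 × ZMod 3), i ≠ j ∧ t = faceClassQ (ZMod 3 × ZMod 3) φ i j) ∧
      hodgeLattice (πQ (ZMod 3 × ZMod 3)) (φQ (ZMod 3 × ZMod 3)) ≤ OddDegreeParityLaw.pairs ⊔
        Submodule.span ℤ {v | ∃ g : ZMod 2 × (ZMod 3 × ZMod 3), ∃ t ∈ S,
          v = OddDegreeParityLaw.transl (πQ (ZMod 3 × ZMod 3)) g t} := by
  rw [← OddDegreeParityLaw.card_orbitsA_zmod_three_sq]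
  exact oddSlice_faces (ZMod 3 × ZMod 3) (by rw [Fintype.card_prod, ZMod.card]; decide)

/-- **Degree `30`, cyclic (`ℚ(ζ₃₁)`, …): `μ(ℤ/30) = 1095`, attained by `1095` rank-four face classes** (no certificate existed in this
degree). [folklore] -/
theorem zmod_fifteen_faces :
    ∃ S : Finset (Pt (AbQ (ZMod 15)) → ℤ), S.card = 1095 ∧
      (∀ t ∈ S, ∃ (φ : Ty (ZMod 15)) (i j : ZMod 15), i ≠ j ∧ t = faceClassQ (ZMod 15) φ i j) ∧
      hodgeLattice (πQ (ZMod 15)) (φQ (ZMod 15)) ≤ OddDegreeParityLaw.pairs ⊔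
        Submodule.span ℤ {v | ∃ g : ZMod 2 × ZMod 15, ∃ t ∈ S, v = OddDegreeParityLaw.transl (πQ (ZMod 15)) g t} := by
  rw [← OddDegreeParityLaw.card_orbitsA_zmod_fifteen]
  exact oddSlice_faces (ZMod 15) (by rw [ZMod.card]; decide)

end Summit.HodgeConjecture.CorCM.Census.OddSliceFacesRecord
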